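import Summits.ValiantsHypothesis.ValiantsHypothesis.Theorems.BarrierLeverAnchoredDoorHitsLowerPairsDecrementGeneralDefs

/-!
# Support item `AnchoredDoorHitsLowerPairs` (stmt-ValiantsHypothesis-22510), line `anchored-peeling`:
# THE DECREMENT CERTIFICATE FOR GENERAL `k` — BLOCKS OF THE DECREMENT DOORS, SUPPORTS OF SMALL COLUMNS, BLOCK SHAPES OF THE THREE VERTEX TYPES

Helper file (`--supports stmt-ValiantsHypothesis-22510`; cell valiant-natproofs, rung V4, 𝒟-side door (c); registered line
`Cruxes/AnchoredDoorHitsLowerPairs/Lines/anchored_peeling.lean` v20, registered stub `Stmt.stub_decrementFamily` (CONJECTURE DC, `…DecrementFamily`,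
p650456); prover seat val-np-p1 gen 23; memo HOME/val-np-p1/g22/MEMO-relapex-valnp1-g22.md §12–§15 = the paper proof being formalised; definitions in
`…DecrementGeneralDefs` (p652973)). Closes NO item by itself; part of the kernel proof of `theorem stub_decrementFamily` (`…DecrementGeneral`).

WHAT. (§7 of the development.) Decoding facts for `aIdx / eBit / bIdx` (unions, disjointness), `doorSupp_singleton_iff` / `doorSupp_pair_iff` (the support
of a vertex = its blocks, of an edge = disjoint unions of one block per end), the SHAPE of a block of each vertex type (`isBlock_gam`: persona `a_S`,
`ρ(P) ∈ S ⊆ P`, or `α ∪ b_Y`, `Y ⊆ P`; `isBlock_om`: `{α}`; `isBlock_del`: persona `b_T`, `ρ(Q) ∈ T ⊆ Q`, or `α ∪ a_Y`, `Y ⊆ Q − 1`) — the block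
constructors and the diagonal are in `…DecrementGeneralSupport`.

WHAT THIS IS NOT: nothing on crux stmt-ValiantsHypothesis-14610 or on `VP` versus `VNP`.
-/

set_option linter.dupNamespace false

namespace Summit.ValiantsHypothesis.ValiantsHypothesis.Theorems.BarrierLever.AnchoredPeeling

namespace DecFamily

open Finset

variable {h : ℕ}

/-! ## 7. Blocks of the decrement doors: decoding facts, union, the three vertex types, supports of small columns, the diagonal -/

section Blocks

variable {k : ℕ}

/-! ### Decoding facts -/

/-- No variable `k` in `X` ⇒ `eBit = false`. -/
theorem eBit_eq_false_of {X : Finset (Fin h)} (hX : ∀ x ∈ X, x.val ≠ k) : eBit k X = false := by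
  rw [Bool.eq_false_iff, ne_eq, eBit_eq_true_iff]
  rintro ⟨x, hx, hxk⟩; exact hX x hx hxk

/-- A variable `k` in `X` ⇒ `eBit = true`. -/
theorem eBit_eq_true_of {X : Finset (Fin h)} {x : Fin h} (hx : x ∈ X) (hxk : x.val = k) : eBit k X = true :=
  eBit_eq_true_iff.mpr ⟨x, hx, hxk⟩

/-- All variables `≤ k` ⇒ `bIdx = ∅`. -/
theorem bIdx_eq_empty_of {X : Finset (Fin h)} (hX : ∀ x ∈ X, x.val ≤ k) : bIdx k X = ∅ := by
  rw [Finset.eq_empty_iff_forall_notMem]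
  intro j hj
  obtain ⟨x, hx, hxj⟩ := mem_bIdx.mp hj
  have := hX x hx; omega

/-- All variables `≥ k` ⇒ `aIdx = ∅`. -/
theorem aIdx_eq_empty_of {X : Finset (Fin h)} (hX : ∀ x ∈ X, k ≤ x.val) : aIdx k X = ∅ := by
  rw [Finset.eq_empty_iff_forall_notMem]
  intro i hi
  obtain ⟨hik, x, hx, hxi⟩ := mem_aIdx.mp hi
  have := hX x hx; omega

/-- Bounding `aIdx`. -/
theorem aIdx_subset_of {X : Finset (Fin h)} {P : Finset ℕ} (hX : ∀ x ∈ X, x.val < k → x.val ∈ P) : aIdx k X ⊆ P := by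
  intro i hi
  obtain ⟨hik, x, hx, hxi⟩ := mem_aIdx.mp hi
  rw [← hxi]; exact hX x hx (by omega)

/-- Bounding `bIdx`. -/
theorem bIdx_subset_of {X : Finset (Fin h)} {P : Finset ℕ} (hX : ∀ x ∈ X, k < x.val → x.val - (k + 1) ∈ P) : bIdx k X ⊆ P := by
  intro j hj
  obtain ⟨x, hx, hxj⟩ := mem_bIdx.mp hj
  have := hX x hx (by omega)
  rwa [show x.val - (k + 1) = j by omega] at this

/-- Members give `aIdx` elements. -/
theorem mem_aIdx_of {X : Finset (Fin h)} {x : Fin h} (hx : x ∈ X) (hxk : x.val < k) : x.val ∈ aIdx k X :=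
  mem_aIdx.mpr ⟨hxk, x, hx, rfl⟩

/-- Members give `bIdx` elements. -/
theorem mem_bIdx_of {X : Finset (Fin h)} {x : Fin h} (hx : x ∈ X) (hkx : k < x.val) : x.val - (k + 1) ∈ bIdx k X :=
  mem_bIdx.mpr ⟨x, hx, by omega⟩

/-- `aIdx` of a union. -/
theorem aIdx_union (X Y : Finset (Fin h)) : aIdx k (X ∪ Y) = aIdx k X ∪ aIdx k Y := by
  ext i; simp only [mem_aIdx, Finset.mem_union]
  constructor
  · rintro ⟨hik, x, hx | hx, hxi⟩
    · exact Or.inl ⟨hik, x, hx, hxi⟩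
    · exact Or.inr ⟨hik, x, hx, hxi⟩
  · rintro (⟨hik, x, hx, hxi⟩ | ⟨hik, x, hx, hxi⟩)
    · exact ⟨hik, x, Or.inl hx, hxi⟩
    · exact ⟨hik, x, Or.inr hx, hxi⟩

/-- `bIdx` of a union. -/
theorem bIdx_union (X Y : Finset (Fin h)) : bIdx k (X ∪ Y) = bIdx k X ∪ bIdx k Y := by
  ext j; simp only [mem_bIdx, Finset.mem_union]
  constructor
  · rintro ⟨x, hx | hx, hxj⟩
    · exact Or.inl ⟨x, hx, hxj⟩
    · exact Or.inr ⟨x, hx, hxj⟩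
  · rintro (⟨x, hx, hxj⟩ | ⟨x, hx, hxj⟩)
    · exact ⟨x, Or.inl hx, hxj⟩
    · exact ⟨x, Or.inr hx, hxj⟩

/-- `eBit` of a union. -/
theorem eBit_union (X Y : Finset (Fin h)) : eBit k (X ∪ Y) = (eBit k X || eBit k Y) := by
  rcases Bool.eq_false_or_eq_true (eBit k X) with hX | hX
  · obtain ⟨x, hx, hxk⟩ := eBit_eq_true_iff.mp hX
    rw [hX, Bool.true_or]; exact eBit_eq_true_of (Finset.mem_union_left Y hx) hxk
  · rcases Bool.eq_false_or_eq_true (eBit k Y) with hY | hY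
    · obtain ⟨y, hy, hyk⟩ := eBit_eq_true_iff.mp hY
      rw [hY, Bool.or_true]; exact eBit_eq_true_of (Finset.mem_union_right X hy) hyk
    · rw [hX, hY, Bool.or_false]
      apply eBit_eq_false_of
      intro z hz hzk
      rcases Finset.mem_union.mp hz with hz | hz
      · exact absurd (eBit_eq_true_of hz hzk) (by rw [hX]; exact Bool.false_ne_true)
      · exact absurd (eBit_eq_true_of hz hzk) (by rw [hY]; exact Bool.false_ne_true)

/-- Disjoint faces have disjoint `aIdx`. -/
theorem disjoint_aIdx {X Y : Finset (Fin h)} (hXY : Disjoint X Y) : Disjoint (aIdx k X) (aIdx k Y) := by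
  rw [Finset.disjoint_left]
  intro i hiX hiY
  obtain ⟨_, x, hx, hxi⟩ := mem_aIdx.mp hiX
  obtain ⟨_, y, hy, hyi⟩ := mem_aIdx.mp hiY
  have : x = y := Fin.ext (by omega)
  subst this
  exact Finset.disjoint_left.mp hXY hx hy

/-- Disjoint faces have disjoint `bIdx`. -/
theorem disjoint_bIdx {X Y : Finset (Fin h)} (hXY : Disjoint X Y) : Disjoint (bIdx k X) (bIdx k Y) := by
  rw [Finset.disjoint_left]
  intro j hjX hjY
  obtain ⟨x, hx, hxj⟩ := mem_bIdx.mp hjX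
  obtain ⟨y, hy, hyj⟩ := mem_bIdx.mp hjY
  have : x = y := Fin.ext (by omega)
  subst this
  exact Finset.disjoint_left.mp hXY hx hy

/-- Disjoint faces do not both contain the variable `k`. -/
theorem not_eBit_and {X Y : Finset (Fin h)} (hXY : Disjoint X Y) : ¬ (eBit k X = true ∧ eBit k Y = true) := by
  rintro ⟨hX, hY⟩
  obtain ⟨x, hx, hxk⟩ := eBit_eq_true_iff.mp hX
  obtain ⟨y, hy, hyk⟩ := eBit_eq_true_iff.mp hY
  have : x = y := Fin.ext (by omega)
  subst this
  exact Finset.disjoint_left.mp hXY hx hy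

/-- Union of two `rowOf`s. -/
theorem rowOf_union (S₁ S₂ T₁ T₂ : Finset ℕ) (e₁ e₂ : Bool) :
    rowOf (h := h) k S₁ e₁ T₁ ∪ rowOf k S₂ e₂ T₂ = rowOf k (S₁ ∪ S₂) (e₁ || e₂) (T₁ ∪ T₂) := by
  ext x
  simp only [Finset.mem_union, mem_rowOf, Bool.or_eq_true]
  tauto

/-- Disjointness of two `rowOf`s from disjoint data. -/
theorem disjoint_rowOf {S₁ S₂ T₁ T₂ : Finset ℕ} {e₁ e₂ : Bool} (hS : Disjoint S₁ S₂) (he : ¬ (e₁ = true ∧ e₂ = true)) (hT : Disjoint T₁ T₂) :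
    Disjoint (rowOf (h := h) k S₁ e₁ T₁) (rowOf k S₂ e₂ T₂) := by
  rw [Finset.disjoint_left]
  intro x h1 h2
  rcases mem_rowOf.mp h1 with ⟨a1, a2⟩ | ⟨b1, b2⟩ | ⟨c1, c2⟩ <;> rcases mem_rowOf.mp h2 with ⟨a1', a2'⟩ | ⟨b1', b2'⟩ | ⟨c1', c2'⟩
  · exact Finset.disjoint_left.mp hS a2 a2'
  · omega
  · omega
  · omega
  · exact he ⟨b2, b2'⟩
  · omega
  · omega
  · omega
  · exact Finset.disjoint_left.mp hT c2 c2'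

/-! ### Supports of the empty column, a vertex, an edge -/

/-- Support of a single vertex = its blocks. -/
theorem doorSupp_singleton_iff (B : Fin h → Finset (Fin h)) (T : Fin h → Fin h → Finset (Fin h)) (v : Fin h) (U : Finset (Fin h)) :
    DoorSupp B T {v} U ↔ IsBlock B T v U := by
  constructor
  · rintro ⟨S, hroot, -, hU⟩
    rw [Finset.singleton_biUnion] at hU
    obtain ⟨b, hb, hbS, hST⟩ := hroot v (Finset.mem_singleton_self v)
    exact ⟨b, hb, hU ▸ hbS, hU ▸ hST⟩
  · rintro ⟨b, hb, hbU, hUT⟩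
    refine ⟨fun _ => U, fun γ hγ => ?_, fun γ hγ γ' hγ' hne => ?_, by rw [Finset.singleton_biUnion]⟩
    · rw [Finset.mem_singleton] at hγ; subst hγ; exact ⟨b, hb, hbU, hUT⟩
    · rw [Finset.mem_singleton] at hγ hγ'; exact absurd (hγ.trans hγ'.symm) hne

/-- Support of an edge = disjoint unions of a block of each end. -/
theorem doorSupp_pair_iff (B : Fin h → Finset (Fin h)) (T : Fin h → Fin h → Finset (Fin h)) {v w : Fin h} (hvw : v ≠ w) (U : Finset (Fin h)) :
    DoorSupp B T {v, w} U ↔ ∃ X Y, IsBlock B T v X ∧ IsBlock B T w Y ∧ Disjoint X Y ∧ X ∪ Y = U := by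
  classical
  constructor
  · rintro ⟨S, hroot, hdisj, hU⟩
    refine ⟨S v, S w, ?_, ?_, hdisj v (by simp) w (by simp) hvw, ?_⟩
    · obtain ⟨b, hb, hbS, hST⟩ := hroot v (by simp); exact ⟨b, hb, hbS, hST⟩
    · obtain ⟨b, hb, hbS, hST⟩ := hroot w (by simp); exact ⟨b, hb, hbS, hST⟩
    · rw [← hU, Finset.biUnion_insert, Finset.singleton_biUnion]
  · rintro ⟨X, Y, ⟨b, hb, hbX, hXT⟩, ⟨b', hb', hbY, hYT⟩, hXY, hU⟩
    refine ⟨fun γ => if γ = v then X else Y, fun γ hγ => ?_, fun γ hγ γ' hγ' hne => ?_, ?_⟩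
    · rcases Finset.mem_insert.mp hγ with rfl | hγ
      · exact ⟨b, hb, by simp [hbX], by simp [hXT]⟩
      · rw [Finset.mem_singleton] at hγ; subst hγ
        exact ⟨b', hb', by simp [hvw.symm, hbY], by simp [hvw.symm, hYT]⟩
    · have hγv : γ = v ∨ γ = w := by simpa using hγ
      have hγ'v : γ' = v ∨ γ' = w := by simpa using hγ'
      rcases hγv with rfl | rfl <;> rcases hγ'v with rfl | rfl
      · exact absurd rfl hne
      · simp [hvw.symm, hXY]
      · simp [hvw.symm, hXY.symm]
      · exact absurd rfl hne
    · rw [Finset.biUnion_insert, Finset.singleton_biUnion]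
      simp [hvw.symm, hU]

/-! ### The three vertex types: shape of a block -/

/-- **A block of `γ_P`** (`c = v.val+1 = P < 2^k`): the persona `a_S`, `ρ(P) ∈ S ⊆ P`, or the `α`-block `α ∪ b_Y`, `Y ⊆ P`. -/
theorem isBlock_gam {v : Fin h} {c : ℕ} {X : Finset (Fin h)} (hv : v.val + 1 = c) (hc : c < 2 ^ k) (hX : IsBlock (roots k) (tails k) v X) :
    (∀ x ∈ X, x.val ≤ 2 * k) ∧
    ((eBit k X = false ∧ bIdx k X = ∅ ∧ aIdx k X ⊆ bits c ∧ rho c ∈ aIdx k X) ∨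
     (eBit k X = true ∧ aIdx k X = ∅ ∧ bIdx k X ⊆ bits c)) := by
  subst hv
  obtain ⟨b, hb, hbX, hXT⟩ := hX
  have hρk : rho (v.val + 1) < k := rho_lt (by omega) hc
  have hρP : rho (v.val + 1) ∈ bits (v.val + 1) := rho_mem_bits (by omega)
  have hPr : bits (v.val + 1) ⊆ range k := bits_subset_range hc
  rcases mem_roots.mp hb with hbk | ⟨-, hbρ⟩ | ⟨hgt, -⟩
  · -- α-block
    have hmem : ∀ x ∈ X, x ≠ b → k < x.val ∧ x.val - (k + 1) ∈ bits (v.val + 1) := by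
      intro x hx hxb
      have := hXT hx
      rw [Finset.mem_insert] at this
      rcases this with h | h
      · exact absurd h hxb
      rcases mem_tails.mp h with ⟨-, ⟨hb1, -⟩ | ⟨-, h2, h3⟩⟩ | ⟨h4, -⟩
      · omega
      · exact ⟨h2, h3⟩
      · omega
    refine ⟨fun x hx => ?_, Or.inr ⟨eBit_eq_true_of hbX hbk, aIdx_eq_empty_of fun x hx => ?_, bIdx_subset_of fun x hx hkx => ?_⟩⟩
    · by_cases hxb : x = b
      · subst hxb; omega
      · have := mem_range.mp (hPr (hmem x hx hxb).2); omega
    · by_cases hxb : x = b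
      · subst hxb; omega
      · have := (hmem x hx hxb).1; omega
    · exact (hmem x hx (fun hxb => by subst hxb; omega)).2
  · -- persona
    have hmem : ∀ x ∈ X, x.val < k ∧ x.val ∈ bits (v.val + 1) := by
      intro x hx
      have := hXT hx
      rw [Finset.mem_insert] at this
      rcases this with h | h
      · subst h; exact ⟨by omega, hbρ ▸ hρP⟩
      rcases mem_tails.mp h with ⟨-, ⟨-, h1, h2, -⟩ | ⟨hb2, -⟩⟩ | ⟨h4, -⟩
      · exact ⟨h1, h2⟩
      · omega
      · omega
    refine ⟨fun x hx => by have := (hmem x hx).1; omega, Or.inl ⟨eBit_eq_false_of fun x hx => by have := (hmem x hx).1; omega,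
      bIdx_eq_empty_of fun x hx => by have := (hmem x hx).1; omega, aIdx_subset_of fun x hx _ => (hmem x hx).2, ?_⟩⟩
    rw [← hbρ]; exact mem_aIdx_of hbX (by omega)
  · omega

/-- **A block of `ω`** (`v.val + 1 = 2^k`): `{α}` only. -/
theorem isBlock_om {v : Fin h} {X : Finset (Fin h)} (hc : v.val + 1 = 2 ^ k) (hX : IsBlock (roots k) (tails k) v X) :
    (∀ x ∈ X, x.val ≤ 2 * k) ∧ aIdx k X = ∅ ∧ eBit k X = true ∧ bIdx k X = ∅ := by
  obtain ⟨b, hb, hbX, hXT⟩ := hX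
  have hbk : b.val = k := by
    rcases mem_roots.mp hb with h | ⟨h, -⟩ | ⟨h, -⟩
    · exact h
    · omega
    · omega
  have hmem : ∀ x ∈ X, x = b := by
    intro x hx
    have := hXT hx
    rw [Finset.mem_insert] at this
    rcases this with h | h
    · exact h
    rcases mem_tails.mp h with ⟨h1, -⟩ | ⟨h2, -⟩
    · omega
    · omega
  refine ⟨fun x hx => ?_, aIdx_eq_empty_of fun x hx => ?_, eBit_eq_true_of hbX hbk, bIdx_eq_empty_of fun x hx => ?_⟩
  · rw [hmem x hx]; omega
  · rw [hmem x hx]; omega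
  · rw [hmem x hx]; omega

/-- **A block of `δ_Q`** (`c = v.val+1 = 2^k + Q`, `1 ≤ Q < 2^k`): the persona `b_T`, `ρ(Q) ∈ T ⊆ Q`, or the `α`-block `α ∪ a_Y`, `Y ⊆ Q − 1`. -/
theorem isBlock_del {v : Fin h} {Q : ℕ} {X : Finset (Fin h)} (hv : v.val + 1 = 2 ^ k + Q) (hQ1 : 1 ≤ Q) (hQ : Q < 2 ^ k)
    (hX : IsBlock (roots k) (tails k) v X) :
    (∀ x ∈ X, x.val ≤ 2 * k) ∧
    ((eBit k X = false ∧ aIdx k X = ∅ ∧ bIdx k X ⊆ bits Q ∧ rho Q ∈ bIdx k X) ∨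
     (eBit k X = true ∧ bIdx k X = ∅ ∧ aIdx k X ⊆ bits (Q - 1))) := by
  have hc : 2 ^ k < v.val + 1 := by omega
  have hQv : v.val + 1 - 2 ^ k = Q := by omega
  rw [← hQv] at hQ ⊢
  clear hQ1
  obtain ⟨b, hb, hbX, hXT⟩ := hX
  have hQ1 : v.val + 1 - 2 ^ k ≠ 0 := by omega
  have hρk : rho (v.val + 1 - 2 ^ k) < k := rho_lt hQ1 hQ
  have hρQ : rho (v.val + 1 - 2 ^ k) ∈ bits (v.val + 1 - 2 ^ k) := rho_mem_bits hQ1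
  have hQr : bits (v.val + 1 - 2 ^ k) ⊆ range k := bits_subset_range hQ
  have hQ1r : bits ((v.val + 1 - 2 ^ k) - 1) ⊆ range k := bits_subset_range (by omega)
  rcases mem_roots.mp hb with hbk | ⟨hlt, -⟩ | ⟨-, hbρ⟩
  · -- α-block
    have hmem : ∀ x ∈ X, x ≠ b → x.val < k ∧ x.val ∈ bits ((v.val + 1 - 2 ^ k) - 1) := by
      intro x hx hxb
      have := hXT hx
      rw [Finset.mem_insert] at this
      rcases this with h | h
      · exact absurd h hxb
      rcases mem_tails.mp h with ⟨h0, -⟩ | ⟨-, ⟨hb1, -⟩ | ⟨-, h2, h3⟩⟩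
      · omega
      · omega
      · exact ⟨h2, h3⟩
    refine ⟨fun x hx => ?_, Or.inr ⟨eBit_eq_true_of hbX hbk, bIdx_eq_empty_of fun x hx => ?_, aIdx_subset_of fun x hx _ => ?_⟩⟩
    · by_cases hxb : x = b
      · subst hxb; omega
      · have := (hmem x hx hxb).1; omega
    · by_cases hxb : x = b
      · subst hxb; omega
      · have := (hmem x hx hxb).1; omega
    · exact (hmem x hx (fun hxb => by subst hxb; omega)).2
  · omega
  · -- persona
    have hmem : ∀ x ∈ X, k < x.val ∧ x.val - (k + 1) ∈ bits (v.val + 1 - 2 ^ k) := by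
      intro x hx
      have := hXT hx
      rw [Finset.mem_insert] at this
      rcases this with h | h
      · subst h; exact ⟨by omega, by rw [show x.val - (k + 1) = rho (v.val + 1 - 2 ^ k) by omega]; exact hρQ⟩
      rcases mem_tails.mp h with ⟨h0, -⟩ | ⟨-, ⟨-, h1, h2, -⟩ | ⟨hb2, -⟩⟩
      · omega
      · exact ⟨h1, h2⟩
      · omega
    refine ⟨fun x hx => ?_, Or.inl ⟨eBit_eq_false_of fun x hx => by have := (hmem x hx).1; omega,
      aIdx_eq_empty_of fun x hx => by have := (hmem x hx).1; omega, bIdx_subset_of fun x hx _ => (hmem x hx).2, ?_⟩⟩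
    · have := mem_range.mp (hQr (hmem x hx).2); omega
    · have := mem_bIdx_of (k := k) hbX (by omega)
      rwa [show b.val - (k + 1) = rho (v.val + 1 - 2 ^ k) by omega] at this

end Blocks

end DecFamily

end Summit.ValiantsHypothesis.ValiantsHypothesis.Theorems.BarrierLever.AnchoredPeeling
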